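import Mathlib
import HarnessLib
import Literature.Computability.AlgebraicComplexity.AsymptoticSpectrum
import Literature.Computability.AlgebraicComplexity.BorderRankCW
import Literature.Computability.AlgebraicComplexity.BILPS19MinrankVarieties
import Literature.Computability.AlgebraicComplexity.DegenerationSpectralMonotone
import Literature.Barriers.MatrixMultiplication.UniversalMethodBarrier
import Summits.MatrixMultiplication.MatrixMultiplication.Theorems.SoloInformedConverseDoorLimit
import Summits.MatrixMultiplication.MatrixMultiplication.Theorems.OutsiderSandwichPolystableRigidity
import Summits.MatrixMultiplication.MatrixMultiplication.Theorems.OutsiderSandwichCwTwoPowPolystable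
import Summits.MatrixMultiplication.MatrixMultiplication.Theorems.OutsiderSandwichUnitKroneckerRigidity
import Summits.MatrixMultiplication.MatrixMultiplication.Theorems.OutsiderSandwichMinrankGap
import Summits.MatrixMultiplication.MatrixMultiplication.Theorems.OutsiderSandwichRestrictionGap
import Summits.MatrixMultiplication.MatrixMultiplication.Theorems.OutsiderSandwichDegenerationBridge
import Summits.MatrixMultiplication.MatrixMultiplication.Theorems.OutsiderSandwichMinrankExact

/-!
# OutsiderSandwich — the two-sided gap: at every finite level the two sides of an exchange rung `p/q` are
degeneration-incomparable unless `p = q` (lens-4 g33, K33-E part 2)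

Route-independent support kernel (no `Theses` import, no new definitions).

With the exact minranks `minrank(⟨n⟩ ⊠ cw₂^{⊠N}) = 2^N`, `minrank(⟨n'⟩ ⊠ ⟨m,m,m⟩) = m`
(`OutsiderSandwichMinrankExact`) and the transport of `𝓜_r` in both directions along the Kempf–Ness
isomorphism `w₁ = c • (s₁ ⊗ s₂ ⊗ s₃)·w₀` that every orbit-closure degeneration between polystable tensors is
(`exists_smul_sl3_eq_of_degeneratesTo`):

* `eq_two_pow_of_degeneratesTo` / `eq_two_pow_of_degeneratesTo_rev` — a degeneration between `⟨n⟩ ⊠ cw₂^{⊠N}`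
  and a relabelled `⟨n'⟩ ⊠ ⟨m,m,m⟩`, in EITHER direction, forces `m = 2^N`;
* for `m ≠ 2^N` and equal formats `n·3^N = n'·m²`: no restriction, no `ℂ[ε]`-degeneration of any order (BCS
  `⊴_h`), no Alman degeneration, in either direction (`not_restrictsTo_of_ne`, `not_restrictsTo_rev_of_ne`,
  `not_algDegeneratesTo_of_ne`, `not_algDegeneratesTo_rev_of_ne`, `not_polyDegeneratesTo_of_ne`);
* the g31/g32 exchange ladder: at every level `L ≥ 1` the two sides `⟨4^{pL}⟩ ⊠ cw₂^{⊠qL}` and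
  `⟨3^{qL}⟩ ⊠ ⟨2^{pL},2^{pL},2^{pL}⟩` of rung `p/q` are degeneration-incomparable unless `p = q`
  (`rung_not_algDegeneratesTo_of_ne`, `rung_not_algDegeneratesTo_rev_of_ne`,
  `rung_not_restrictsTo_either_of_ne`); e.g. the two format-`36` tensors `⟨4⟩ ⊠ cw₂^{⊠2}`, `⟨9⟩ ⊠ ⟨2,2,2⟩`.

Honest tag: `ω`-free NEGATIVE CALIBRATION (the rungs are intrinsically asymptotic; the `o(L)` slack / the
catalysing unit tensors of `≲` are essential — note the theorems are uniform in the unit multiplicities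
`n, n'`, so finite unit-tensor catalysts do not help at any fixed level).  Silent exactly on the slope-one
line `m = 2^N`.

References: [cite: KempfNess1979, Thm. 0.2]; [cite: BlaserIkenmeyerLysikovPandeySchreyer2019, Lemma 18];
[cite: BurgisserClausenShokrollahi1997, (15.19), (15.25)]; [cite: Alman2021, §2.4]; [cite: Strassen1988, Thm. 3.8].
-/

noncomputable section

open scoped BigOperators Matrix

open Literature.Computability.AlgebraicComplexity
open Literature.Barriers.MatrixMultiplication

namespace Summit.MatrixMultiplication.MatrixMultiplication.Theorems.OutsiderSandwichTwoSidedGap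

open OutsiderSandwichPolystableRigidity OutsiderSandwichCwTwoPowPolystable
  OutsiderSandwichUnitKroneckerRigidity OutsiderSandwichMinrankGap OutsiderSandwichRestrictionGap
  OutsiderSandwichDegenerationBridge OutsiderSandwichMinrankExact

/-! ## §1  Degenerations in either direction force `m = 2^N` -/

section TwoSided

/-- **A degeneration `⟨n⟩ ⊠ cw₂^{⊠N} ⊵ e^*(⟨n'⟩ ⊠ ⟨m,m,m⟩)` forces `m = 2^N`** (`n', m ≥ 1`): the two tensors are
then isomorphic up to a scalar (Kempf–Ness rigidity of polystable tensors), and `minrank` is `2^N` on one side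
and `m` on the other. [cite: KempfNess1979, Thm. 0.2] [cite: BlaserIkenmeyerLysikovPandeySchreyer2019, Lemma 18] -/
theorem eq_two_pow_of_degeneratesTo {n N n' m : ℕ} (hn' : 0 < n') (hm : 0 < m)
    (e : (Fin n × (Fin N → Fin 3)) ≃ (Fin n' × (Fin m × Fin m)))
    (hdeg : TensorDegeneratesTo (kroneckerTensor (unitTensor ℂ n) (kroneckerPow (cwTensor ℂ 2) N))
      (fun a b c => kroneckerTensor (unitTensor ℂ n') (matMulTensor ℂ m m m) (e a) (e b) (e c))) :
    m = 2 ^ N := by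
  classical
  have hn : 0 < n := Fin.pos (e.symm (⟨0, hn'⟩, (⟨0, hm⟩, ⟨0, hm⟩))).1
  haveI : Nonempty (Fin n × (Fin N → Fin 3)) := ⟨e.symm (⟨0, hn'⟩, (⟨0, hm⟩, ⟨0, hm⟩))⟩
  obtain ⟨c, s, hc, hiso⟩ := exists_smul_sl3_eq_of_degeneratesTo hdeg
    (isPolystableTensor_unitKronecker_cwTwoPow n N)
    (isPolystableTensor_relabel e (isPolystableTensor_unitKronecker_matMul n' m))
    (relabel_unitKronecker_matMul_ne_zero hn' hm e)
  refine le_antisymm (not_lt.mp fun hlt => ?_) (not_lt.mp fun hlt => ?_)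
  · refine not_mem_minrankSet_relabel_unitKronecker_matMul hlt e ?_
    rw [hiso]
    exact smul_actTensor_mem_minrankSet hc s (mem_minrankSet_unitKronecker_cwPow hn)
  · exact not_mem_minrankSet_unitKronecker_cwTwoPow hlt
      (mem_minrankSet_of_eq_smul_actTensor hc s hiso
        (mem_minrankSet_relabel_unitKronecker_matMul hn' hm e))

/-- **The reverse direction**: a degeneration `e^*(⟨n'⟩ ⊠ ⟨m,m,m⟩) ⊵ ⟨n⟩ ⊠ cw₂^{⊠N}` also forces `m = 2^N`.
[cite: KempfNess1979, Thm. 0.2] [cite: BlaserIkenmeyerLysikovPandeySchreyer2019, Lemma 18] -/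
theorem eq_two_pow_of_degeneratesTo_rev {n N n' m : ℕ} (hn' : 0 < n') (hm : 0 < m)
    (e : (Fin n × (Fin N → Fin 3)) ≃ (Fin n' × (Fin m × Fin m)))
    (hdeg : TensorDegeneratesTo
      (fun a b c => kroneckerTensor (unitTensor ℂ n') (matMulTensor ℂ m m m) (e a) (e b) (e c))
      (kroneckerTensor (unitTensor ℂ n) (kroneckerPow (cwTensor ℂ 2) N))) :
    m = 2 ^ N := by
  classical
  have hn : 0 < n := Fin.pos (e.symm (⟨0, hn'⟩, (⟨0, hm⟩, ⟨0, hm⟩))).1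
  haveI : Nonempty (Fin n × (Fin N → Fin 3)) := ⟨e.symm (⟨0, hn'⟩, (⟨0, hm⟩, ⟨0, hm⟩))⟩
  obtain ⟨c, s, hc, hiso⟩ := exists_smul_sl3_eq_of_degeneratesTo hdeg
    (isPolystableTensor_relabel e (isPolystableTensor_unitKronecker_matMul n' m))
    (isPolystableTensor_unitKronecker_cwTwoPow n N)
    (unitKronecker_cwTwoPow_ne_zero hn)
  refine le_antisymm (not_lt.mp fun hlt => ?_) (not_lt.mp fun hlt => ?_)
  · exact not_mem_minrankSet_relabel_unitKronecker_matMul hlt e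
      (mem_minrankSet_of_eq_smul_actTensor hc s hiso (mem_minrankSet_unitKronecker_cwPow hn))
  · refine not_mem_minrankSet_unitKronecker_cwTwoPow (n := n) hlt ?_
    rw [hiso]
    exact smul_actTensor_mem_minrankSet hc s (mem_minrankSet_relabel_unitKronecker_matMul hn' hm e)

/-- For `m ≠ 2^N`: `⟨n⟩ ⊠ cw₂^{⊠N} ⋭ e^*(⟨n'⟩ ⊠ ⟨m,m,m⟩)` (extends the `m < 2^N` gap theorem to all `m ≠ 2^N`).
[cite: KempfNess1979, Thm. 0.2] -/
theorem not_degeneratesTo_of_ne {n N n' m : ℕ} (hn' : 0 < n') (hm : 0 < m) (hne : m ≠ 2 ^ N)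
    (e : (Fin n × (Fin N → Fin 3)) ≃ (Fin n' × (Fin m × Fin m))) :
    ¬ TensorDegeneratesTo (kroneckerTensor (unitTensor ℂ n) (kroneckerPow (cwTensor ℂ 2) N))
      (fun a b c => kroneckerTensor (unitTensor ℂ n') (matMulTensor ℂ m m m) (e a) (e b) (e c)) :=
  fun h => hne (eq_two_pow_of_degeneratesTo hn' hm e h)

/-- For `m ≠ 2^N`: `e^*(⟨n'⟩ ⊠ ⟨m,m,m⟩) ⋭ ⟨n⟩ ⊠ cw₂^{⊠N}`. [cite: KempfNess1979, Thm. 0.2] -/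
theorem not_degeneratesTo_rev_of_ne {n N n' m : ℕ} (hn' : 0 < n') (hm : 0 < m) (hne : m ≠ 2 ^ N)
    (e : (Fin n × (Fin N → Fin 3)) ≃ (Fin n' × (Fin m × Fin m))) :
    ¬ TensorDegeneratesTo
      (fun a b c => kroneckerTensor (unitTensor ℂ n') (matMulTensor ℂ m m m) (e a) (e b) (e c))
      (kroneckerTensor (unitTensor ℂ n) (kroneckerPow (cwTensor ℂ 2) N)) :=
  fun h => hne (eq_two_pow_of_degeneratesTo_rev hn' hm e h)

/-- The index bijection of two equal formats `n·3^N = n'·m²`. [folklore] -/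
theorem card_eq_of_format {n N n' m : ℕ} (hfmt : n * 3 ^ N = n' * (m * m)) :
    Fintype.card (Fin n × (Fin N → Fin 3)) = Fintype.card (Fin n' × (Fin m × Fin m)) := by
  simp only [Fintype.card_prod, Fintype.card_fun, Fintype.card_fin]
  exact hfmt

/-- **No restriction `⟨n⟩ ⊠ cw₂^{⊠N} ≥ ⟨n'⟩ ⊠ ⟨m,m,m⟩`** in equal formats unless `m = 2^N`.
[cite: KempfNess1979, Thm. 0.2] -/
theorem not_restrictsTo_of_ne {n N n' m : ℕ} (hn' : 0 < n') (hm : 0 < m) (hne : m ≠ 2 ^ N)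
    (hfmt : n * 3 ^ N = n' * (m * m)) :
    ¬ TensorRestrictsTo (kroneckerTensor (unitTensor ℂ n) (kroneckerPow (cwTensor ℂ 2) N))
      (kroneckerTensor (unitTensor ℂ n') (matMulTensor ℂ m m m)) := fun h =>
  not_degeneratesTo_of_ne hn' hm hne (Fintype.equivOfCardEq (card_eq_of_format hfmt))
    (tensorDegeneratesTo_of_restrictsTo
      (tensorRestrictsTo_relabel (Fintype.equivOfCardEq (card_eq_of_format hfmt)) h))

/-- **No restriction `⟨n'⟩ ⊠ ⟨m,m,m⟩ ≥ ⟨n⟩ ⊠ cw₂^{⊠N}`** in equal formats unless `m = 2^N`.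
[cite: KempfNess1979, Thm. 0.2] -/
theorem not_restrictsTo_rev_of_ne {n N n' m : ℕ} (hn' : 0 < n') (hm : 0 < m) (hne : m ≠ 2 ^ N)
    (hfmt : n * 3 ^ N = n' * (m * m)) :
    ¬ TensorRestrictsTo (kroneckerTensor (unitTensor ℂ n') (matMulTensor ℂ m m m))
      (kroneckerTensor (unitTensor ℂ n) (kroneckerPow (cwTensor ℂ 2) N)) := fun h =>
  not_degeneratesTo_rev_of_ne hn' hm hne (Fintype.equivOfCardEq (card_eq_of_format hfmt))
    (tensorDegeneratesTo_of_restrictsTo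
      (tensorRestrictsTo_relabel_source (Fintype.equivOfCardEq (card_eq_of_format hfmt)) h))

/-- **No `ℂ[ε]`-degeneration of any order `⟨n⟩ ⊠ cw₂^{⊠N} ⊵ ⟨n'⟩ ⊠ ⟨m,m,m⟩`** in equal formats unless
`m = 2^N`. [cite: BurgisserClausenShokrollahi1997, (15.19)] [cite: KempfNess1979, Thm. 0.2] -/
theorem not_algDegeneratesTo_of_ne {n N n' m : ℕ} (hn' : 0 < n') (hm : 0 < m) (hne : m ≠ 2 ^ N)
    (hfmt : n * 3 ^ N = n' * (m * m)) :
    ¬ AlgDegeneratesTo (kroneckerTensor (unitTensor ℂ n) (kroneckerPow (cwTensor ℂ 2) N))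
      (kroneckerTensor (unitTensor ℂ n') (matMulTensor ℂ m m m)) :=
  not_algDegeneratesTo_of_not_degeneratesTo_relabel (Fintype.equivOfCardEq (card_eq_of_format hfmt))
    (not_degeneratesTo_of_ne hn' hm hne _)

/-- **No `ℂ[ε]`-degeneration of any order `⟨n'⟩ ⊠ ⟨m,m,m⟩ ⊵ ⟨n⟩ ⊠ cw₂^{⊠N}`** in equal formats unless
`m = 2^N`. [cite: BurgisserClausenShokrollahi1997, (15.19)] [cite: KempfNess1979, Thm. 0.2] -/
theorem not_algDegeneratesTo_rev_of_ne {n N n' m : ℕ} (hn' : 0 < n') (hm : 0 < m) (hne : m ≠ 2 ^ N)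
    (hfmt : n * 3 ^ N = n' * (m * m)) :
    ¬ AlgDegeneratesTo (kroneckerTensor (unitTensor ℂ n') (matMulTensor ℂ m m m))
      (kroneckerTensor (unitTensor ℂ n) (kroneckerPow (cwTensor ℂ 2) N)) := by
  classical
  intro h
  set e := Fintype.equivOfCardEq (card_eq_of_format hfmt) with he
  have hres : TensorRestrictsTo
      (fun a b c => kroneckerTensor (unitTensor ℂ n') (matMulTensor ℂ m m m) (e a) (e b) (e c))
      (kroneckerTensor (unitTensor ℂ n') (matMulTensor ℂ m m m)) :=
    tensorRestrictsTo_relabel_source e (TensorRestrictsTo.refl _)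
  exact not_degeneratesTo_rev_of_ne hn' hm hne e
    (tensorDegeneratesTo_of_algDegeneratesTo (hres.algDegeneratesTo_trans h))

/-- Same in Alman's convention, both directions. [cite: Alman2021, §2.4] [cite: KempfNess1979, Thm. 0.2] -/
theorem not_polyDegeneratesTo_of_ne {n N n' m : ℕ} (hn' : 0 < n') (hm : 0 < m) (hne : m ≠ 2 ^ N)
    (hfmt : n * 3 ^ N = n' * (m * m)) :
    ¬ PolyDegeneratesTo (kroneckerTensor (unitTensor ℂ n) (kroneckerPow (cwTensor ℂ 2) N))
        (kroneckerTensor (unitTensor ℂ n') (matMulTensor ℂ m m m)) ∧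
      ¬ PolyDegeneratesTo (kroneckerTensor (unitTensor ℂ n') (matMulTensor ℂ m m m))
        (kroneckerTensor (unitTensor ℂ n) (kroneckerPow (cwTensor ℂ 2) N)) :=
  ⟨fun h => not_algDegeneratesTo_of_ne hn' hm hne hfmt
      (ConverseDoorLimit.algDegeneratesTo_of_polyDegeneratesTo h),
    fun h => not_algDegeneratesTo_rev_of_ne hn' hm hne hfmt
      (ConverseDoorLimit.algDegeneratesTo_of_polyDegeneratesTo h)⟩

end TwoSided

/-! ## §2  The ladder: rung `p/q` sides are degeneration-incomparable at every level unless `p = q` -/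

section Rungs

/-- Format bookkeeping for rung `p/q` at level `L`: `4^{pL}·3^{qL} = 3^{qL}·(2^{pL})²`. [folklore] -/
theorem rung_format (p q L : ℕ) :
    4 ^ (p * L) * 3 ^ (q * L) = 3 ^ (q * L) * (2 ^ (p * L) * 2 ^ (p * L)) := by
  rw [← pow_add, show (4 : ℕ) = 2 ^ 2 by norm_num, ← pow_mul, mul_comm (3 ^ (q * L))]
  congr 1
  ring_nf

/-- `2^{pL} ≠ 2^{qL}` for `p ≠ q`, `L ≥ 1`. [folklore] -/
theorem two_pow_ne_of_ne {p q L : ℕ} (hpq : p ≠ q) (hL : 0 < L) : 2 ^ (p * L) ≠ 2 ^ (q * L) := by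
  intro h
  have := Nat.pow_right_injective (le_refl 2) h
  exact hpq (Nat.eq_of_mul_eq_mul_right hL this)

/-- **Rung `p/q`, `p ≠ q`, level `L ≥ 1`: `⟨3^{qL}⟩ ⊠ ⟨2^{pL},2^{pL},2^{pL}⟩` is not a `ℂ[ε]`-degeneration (any
order) of `⟨4^{pL}⟩ ⊠ cw₂^{⊠qL}`.** [cite: BurgisserClausenShokrollahi1997, (15.19)] [cite: KempfNess1979, Thm. 0.2] -/
theorem rung_not_algDegeneratesTo_of_ne {p q L : ℕ} (hpq : p ≠ q) (hL : 0 < L) :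
    ¬ AlgDegeneratesTo
        (kroneckerTensor (unitTensor ℂ (4 ^ (p * L))) (kroneckerPow (cwTensor ℂ 2) (q * L)))
        (kroneckerTensor (unitTensor ℂ (3 ^ (q * L)))
          (matMulTensor ℂ (2 ^ (p * L)) (2 ^ (p * L)) (2 ^ (p * L)))) :=
  not_algDegeneratesTo_of_ne (by positivity) (by positivity) (two_pow_ne_of_ne hpq hL)
    (rung_format p q L)

/-- **… and `⟨4^{pL}⟩ ⊠ cw₂^{⊠qL}` is not a `ℂ[ε]`-degeneration of `⟨3^{qL}⟩ ⊠ ⟨2^{pL},2^{pL},2^{pL}⟩`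
either.** [cite: BurgisserClausenShokrollahi1997, (15.19)] [cite: KempfNess1979, Thm. 0.2] -/
theorem rung_not_algDegeneratesTo_rev_of_ne {p q L : ℕ} (hpq : p ≠ q) (hL : 0 < L) :
    ¬ AlgDegeneratesTo
        (kroneckerTensor (unitTensor ℂ (3 ^ (q * L)))
          (matMulTensor ℂ (2 ^ (p * L)) (2 ^ (p * L)) (2 ^ (p * L))))
        (kroneckerTensor (unitTensor ℂ (4 ^ (p * L))) (kroneckerPow (cwTensor ℂ 2) (q * L))) :=
  not_algDegeneratesTo_rev_of_ne (by positivity) (by positivity) (two_pow_ne_of_ne hpq hL)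
    (rung_format p q L)

/-- Rungs `p/q`, `p ≠ q`: no restriction in either direction at any level `L ≥ 1`. [cite: KempfNess1979, Thm. 0.2] -/
theorem rung_not_restrictsTo_either_of_ne {p q L : ℕ} (hpq : p ≠ q) (hL : 0 < L) :
    ¬ TensorRestrictsTo
        (kroneckerTensor (unitTensor ℂ (4 ^ (p * L))) (kroneckerPow (cwTensor ℂ 2) (q * L)))
        (kroneckerTensor (unitTensor ℂ (3 ^ (q * L)))
          (matMulTensor ℂ (2 ^ (p * L)) (2 ^ (p * L)) (2 ^ (p * L)))) ∧
      ¬ TensorRestrictsTo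
        (kroneckerTensor (unitTensor ℂ (3 ^ (q * L)))
          (matMulTensor ℂ (2 ^ (p * L)) (2 ^ (p * L)) (2 ^ (p * L))))
        (kroneckerTensor (unitTensor ℂ (4 ^ (p * L))) (kroneckerPow (cwTensor ℂ 2) (q * L))) :=
  ⟨not_restrictsTo_of_ne (by positivity) (by positivity) (two_pow_ne_of_ne hpq hL) (rung_format p q L),
    not_restrictsTo_rev_of_ne (by positivity) (by positivity) (two_pow_ne_of_ne hpq hL)
      (rung_format p q L)⟩

/-- The reverse direction of the first open rung at level one: `⟨9⟩ ⊠ ⟨2,2,2⟩ ⋭ ⟨4⟩ ⊠ cw₂^{⊠2}` over `ℂ[ε]`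
(so the two format-`36` tensors are degeneration-incomparable). [cite: KempfNess1979, Thm. 0.2] -/
theorem nineMatMulTwo_not_algDegeneratesTo_fourCwTwoSq :
    ¬ AlgDegeneratesTo (kroneckerTensor (unitTensor ℂ 9) (matMulTensor ℂ 2 2 2))
      (kroneckerTensor (unitTensor ℂ 4) (kroneckerPow (cwTensor ℂ 2) 2)) :=
  not_algDegeneratesTo_rev_of_ne (by norm_num) (by norm_num) (by norm_num) (by norm_num)

end Rungs

end Summit.MatrixMultiplication.MatrixMultiplication.Theorems.OutsiderSandwichTwoSidedGap

end
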